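import Literature.Computability.Complexity.UmansFPPredictor
import HarnessLib

/-!
# Umans' generator, machine level X: the predictor program computes the list predictor of Lemma 13

Literature / circuit complexity — derandomization. Companion of `UmansFPPredictor.lean`: the
program `UmansFP.predLT` on the data `((desc C, w, sgn), (c, 1^q, 1^{I₁}, 1^{J₁}), (1^{d-1}, A₁, 1^{cap₁}, 1^{D₁}))`
computes, on windows of `n₀` represented elements of `L`, the next-element predictor of Umans'
Thm. 14: Yao's predictor `YaoNB.pred C n₀ sgn w` converted by Lemma 13 (`QConv.listPred`:
blockwise Hadamard lists, then Reed–Solomon list recovery).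

* `UmansFP.labM` (the labelling `K ≃ Fin 2^{M+1}` by bitmasks), `vecToL`, `ρN` (`CoordOK`
  automatically: `coordOK_ρN`), `zsOf`, **`predG`** (the mathematical predictor `(Fin n₀ → L) → Finset L`);
* **`predLT_spec`**: faithfulness in the sense of `PredOK` — outputs represent elements of `L`, at
  most `max 1 cap₁` of them, and their set is `predG …` of the represented window.

Everything is proved; no named fact.

## References

* C. Umans, *Pseudo-random generators for all hardnesses*, JCSS 67 (2003), Lemma 13, Lemma 15, Thm. 14 [Umans2003].
* M. Sudan, J. Complexity 13 (1997), §2, Thm. 5 [Sudan1997].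
-/

noncomputable section

namespace Literature.Computability.Complexity

open Polynomial Finset Literature.InformationTheory.Coding Literature.InformationTheory.Coding.SudanRR
open Literature.InformationTheory.Coding.GF2X CodeFP Literature.Computability.MetaComplexity

namespace UmansFP

section PredSpec

variable {M : ℕ} {L : Type*} [Field L] [Algebra (GF2 M) L] [DecidableEq L]
variable {d : ℕ} (N : Module.Basis (Fin d) (GF2 M) L)

/-- **The labelling of `K = GF2 M` by `[0, 2^{M+1})`**: the bitmask. [cite: Umans2003, Lemma 13 (the binary code)] -/
def labM (M : ℕ) : GF2 M ≃ Fin (2 ^ (M + 1)) where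
  toFun v := ⟨toBits M v, toBits_lt M v⟩
  invFun i := GF2.elt M i
  left_inv v := elt_toBits M v
  right_inv i := Fin.ext (toBits_elt M i.2)

/-- The element of `L` with coordinate vector `z`. [folklore] -/
def vecToL (z : Fin d → GF2 M) : L := ∑ j, z j • N j

/-- **The interpretation of `L`-lists**: `u ↦ Σ_j elt(u_j) • N_j`. [cite: Umans2003, §3] -/
def ρN (u : List ℕ) : L := vecToL N fun j => GF2.elt M (u.getD j 0)

omit [DecidableEq L] in
/-- Coordinates of `vecToL`. [folklore] -/
theorem coord_vecToL (z : Fin d → GF2 M) (j : Fin d) : N.coord j (vecToL N z) = z j := by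
  rw [Module.Basis.coord_apply, vecToL, Module.Basis.repr_sum_self]

omit [DecidableEq L] in
/-- `ρN` has faithful coordinates. [folklore] -/
theorem coordOK_ρN : CoordOK d N (ρN N) := fun _ _ j => coord_vecToL N _ j

omit [DecidableEq L] in
/-- `vecToL` is injective. [folklore] -/
theorem vecToL_injective : Function.Injective (vecToL N) := fun z z' h => by
  funext j; rw [← coord_vecToL N z j, ← coord_vecToL N z' j, h]

/-- The coefficient vectors of a window (`0` past its end). [cite: Umans2003, Lemma 13 (proof)] -/
def zsOf {n₀ m : ℕ} (w : Fin n₀ → L) (k : Fin m) : Fin d → GF2 M :=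
  fun j => if h : (k : ℕ) < n₀ then N.coord j (w ⟨k, h⟩) else 0

/-- **The next-element predictor of Thm. 14** obtained from a test `T` on `m` bits: Yao's next-bit
predictor at position `i` with sign `sgn` and coins `wc`, converted by Lemma 13 with thresholds
`D₁` (Hadamard) and `A₁` (Reed–Solomon). [cite: Umans2003, Lemma 13, Thm. 14] -/
def predG {m : ℕ} (T : (Fin m → Bool) → Bool) (i : Fin m) (sgn : Bool) (wc : Fin m → Bool) (D₁ A₁ : ℕ) {n₀ : ℕ}
    (w : Fin n₀ → L) : Finset L :=
  (QConv.listPred (labM M) (YaoNB.pred T i sgn wc) i D₁ A₁ (zsOf N w)).image (vecToL N)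

variable {N}

/-- On a representing list, `symPoly` of the coordinate vector is `polyOfList`. [folklore] -/
theorem symPoly_coeffVec {u : List ℕ} (hu : u.length = d) : QConv.symPoly (fun j : Fin d => GF2.elt M (u.getD j 0)) = polyOfList M u := by
  rw [QConv.symPoly, polyOfList, hu, ← Fin.sum_univ_eq_sum_range]

/-- Counting over `Fin q` against a list count on `[0, q)`. [folklore] -/
theorem card_filter_fin_eq_length {q : ℕ} (Pf : Fin q → Prop) [DecidablePred Pf] (pb : ℕ → Bool)
    (h : ∀ (y : ℕ) (hy : y < q), decide (Pf ⟨y, hy⟩) = pb y) : (univ.filter Pf).card = ((List.range q).filter pb).length := by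
  rw [Finset.card_filter, length_filter_range_eq_sum, ← Fin.sum_univ_eq_sum_range (fun y => if pb y = true then 1 else 0) q]
  refine Finset.sum_congr rfl fun y _ => ?_
  have := h y y.2
  rw [Fin.eta] at this
  by_cases hp : Pf y
  · rw [decide_eq_true hp] at this
    rw [if_pos hp, if_pos this.symm]
  · rw [decide_eq_false hp] at this
    rw [if_neg hp, if_neg (by rw [← this]; exact Bool.false_ne_true)]

omit [DecidableEq L] in
/-- Members of `cands (d-1) A S` are the `symPoly` of the members of `outerList S A` (`d ≥ 1`). [folklore] -/
theorem mem_cands_iff_symPoly {S : GF2 M → Finset (GF2 M)} {A : ℕ} (hd : 1 ≤ d) (f : (GF2 M)[X]) :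
    f ∈ UmansRec.cands (d - 1) A S ↔ ∃ z : Fin d → GF2 M, z ∈ QConv.outerList S A ∧ QConv.symPoly z = f := by
  classical
  rw [UmansRec.mem_cands_iff]
  constructor
  · rintro ⟨hdeg, hA⟩
    refine ⟨fun j => f.coeff j, ?_, ?_⟩
    · rw [QConv.outerList, Finset.mem_filter]
      refine ⟨Finset.mem_univ _, ?_⟩
      suffices e : QConv.symPoly (fun j : Fin d => f.coeff j) = f by rwa [e]
      apply Polynomial.ext; intro n
      rw [QConv.coeff_symPoly]
      split_ifs with h
      · rfl
      · exact (coeff_eq_zero_of_natDegree_lt (by omega)).symm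
    · apply Polynomial.ext; intro n
      rw [QConv.coeff_symPoly]
      split_ifs with h
      · rfl
      · exact (coeff_eq_zero_of_natDegree_lt (by omega)).symm
  · rintro ⟨z, hz, rfl⟩
    rw [QConv.outerList, Finset.mem_filter] at hz
    exact ⟨QConv.natDegree_symPoly_le z, hz.2⟩

/-- **The predictor program is faithful.** For a `B₂`-circuit `C` on `m` bits, a position `i` with
`i = n₀`, sign and coins, the field context `kctx M` (`q = 2^{M+1}`), `d ≥ 1`, and Sudan's numeric
hypotheses (`q ℓ₁ < I₁ J₁` where `ℓ₁ D₁² ≥ 4^{M+1}` bounds the Hadamard lists, `(I₁-1)+(J₁-1)(d-1) < A₁`,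
`J₁ ≤ cap₁`): on every window of `n₀` representing lists the program returns representing lists, at
most `max 1 cap₁` of them, whose values form `predG N C i sgn wc D₁ A₁` of the represented window.
[cite: Umans2003, Lemma 13, Thm. 14] -/
theorem predLT_spec {m n₀ : ℕ} (C : Circuit (Fin m)) (hC : ∀ g ∈ C.gates, g.arity ≤ 2) (i : Fin m) (hi : (i : ℕ) = n₀)
    (sgn : Bool) (wc : Fin m → Bool) {I₁ J₁ A₁ cap₁ D₁ ℓ₁ : ℕ} (hd : 1 ≤ d)
    (hℓ : 4 ^ (M + 1) ≤ ℓ₁ * D₁ ^ 2) (hD₁ : 1 ≤ D₁) (hIJ : 2 ^ (M + 1) * ℓ₁ < I₁ * J₁) (hA : (I₁ - 1) + (J₁ - 1) * (d - 1) < A₁)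
    (hcap : J₁ ≤ cap₁) (ws : List (List ℕ)) (hwl : ws.length = n₀) (hws : ∀ u ∈ ws, LRep M d u) :
    let gd : GDat := ((CircEval.desc C, List.ofFn wc, sgn), (kctx M, 2 ^ (M + 1), I₁, J₁), (d - 1, A₁, cap₁, D₁))
    (∀ u ∈ predLT gd ws, LRep M d u) ∧ (predLT gd ws).length ≤ max 1 cap₁ ∧
      ((predLT gd ws).map (ρN N)).toFinset = predG N (fun x => C.eval x) i sgn wc D₁ A₁ (fun k : Fin n₀ => ρN N (ws.getD k [])) := by
  classical
  intro gd
  set q := 2 ^ (M + 1) with hq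
  set pd : List Bool × List Bool × Bool := (CircEval.desc C, List.ofFn wc, sgn) with hpd
  set Sl := innerTab (kctx M) q D₁ pd ws with hSl
  set P := YaoNB.pred (fun x => C.eval x) i sgn wc with hP
  set zs : Fin m → Fin d → GF2 M := zsOf N (fun k : Fin n₀ => ρN N (ws.getD k [])) with hzs
  have hb : (kctx M).1 - 1 = M + 1 := rfl
  have hF : predLT gd ws = survL (kctx M) q I₁ J₁ (d - 1) A₁ cap₁ Sl [] [] := rfl
  -- the table
  have hSl_b : ∀ a, a < q → Sl.getD a [] = innerRow (kctx M) q D₁ pd ws a := fun a ha => by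
    rw [hSl, innerTab, List.getD_eq_getElem _ _ (by rw [List.length_map, List.length_range]; exact ha), List.getElem_map, List.getElem_range]
  have hSlred : KRedRows M Sl := fun r hr => by
    obtain ⟨a, -, rfl⟩ := List.mem_map.1 hr
    exact fun x hx => List.mem_range.1 (List.mem_of_mem_filter hx)
  -- the coefficient vectors of the window
  have hzs_lt : ∀ (k : Fin m) (hk : (k : ℕ) < n₀), zs k = fun j : Fin d => GF2.elt M ((ws.getD k []).getD (j : ℕ) 0) := fun k hk => by
    funext j
    rw [hzs, zsOf, dif_pos hk]
    exact coord_vecToL N _ j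
  have hws_k : ∀ k, k < n₀ → LRep M d (ws.getD k []) := fun k hk => by
    rw [List.getD_eq_getElem _ _ (by rw [hwl]; exact hk)]; exact hws _ (List.getElem_mem _)
  -- (I) the received bits are the received word of `P`
  have hrecv : ∀ a, a < q → ∀ y (hy : y < q),
      recvBit (kctx M) pd ws a y = QConv.recv (labM M) P i zs (GF2.elt M a, ⟨y, hy⟩) := by
    intro a ha y hy
    rw [recvBit, QConv.recv, hpd, hP]
    refine predP_eq_pred C hC i sgn wc _ _ (by rw [List.length_map, hwl, hi]) fun k hk => ?_
    have hkn : k < n₀ := by rw [← hi]; exact hk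
    rw [List.getD_eq_getElem _ _ (by rw [List.length_map, hwl]; exact hkn), List.getElem_map, if_pos hk, QConv.cw,
      hzs_lt ⟨k, hk.trans i.2⟩ hkn, symPoly_coeffVec (hws_k k hkn).1, ← List.getD_eq_getElem _ [] (by rw [hwl]; exact hkn)]
    obtain ⟨hv, hlt⟩ := keval_spec ha (hws_k k hkn).2
    rw [← hv]
    show hadB ((kctx M).1 - 1) _ y = LDC.hadN (M + 1) (toBits M (GF2.elt M (keval (kctx M) (ws.getD k []) a))) y
    rw [hb, toBits_elt M hlt, hadN_eq]
  -- (II) the Hadamard lists are `innerList`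
  have hmemRow : ∀ a, a < q → ∀ vv, vv ∈ innerRow (kctx M) q D₁ pd ws a ↔ vv < q ∧
      GF2.elt M vv ∈ QConv.innerList (labM M) (QConv.recv (labM M) P i zs) D₁ (GF2.elt M a) := by
    intro a ha vv
    rw [innerRow, List.mem_filter, List.mem_range, decide_eq_true_eq, QConv.innerList, Finset.mem_filter, and_iff_right (Finset.mem_univ _)]
    refine and_congr_right fun hvv => ?_
    rw [card_filter_fin_eq_length _ (fun y => recvBit (kctx M) pd ws a y == hadB ((kctx M).1 - 1) vv y) fun y hy => ?_]
    rw [hrecv a ha y hy, Bool.beq_eq_decide_eq, hb, ← hadN_eq]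
    congr 2
    show LDC.hadN (M + 1) (toBits M (GF2.elt M vv)) y = _
    rw [toBits_elt M hvv]
  have hinner : SOf M Sl = QConv.innerList (labM M) (QConv.recv (labM M) P i zs) D₁ := by
    funext β
    obtain ⟨a, ha, rfl⟩ : ∃ a, a < q ∧ GF2.elt M a = β := ⟨toBits M β, toBits_lt M β, elt_toBits M β⟩
    rw [SOf, toBits_elt M ha, hSl_b a ha]
    ext v
    rw [List.mem_toFinset, List.mem_map]
    constructor
    · rintro ⟨vv, hvv, rfl⟩
      exact ((hmemRow a ha vv).1 hvv).2
    · intro hv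
      refine ⟨toBits M v, (hmemRow a ha _).2 ⟨toBits_lt M v, ?_⟩, elt_toBits M v⟩
      rwa [elt_toBits]
  -- the pair count: Hadamard lists are short
  have hcount : (pairsL q Sl).length < I₁ * J₁ := by
    refine lt_of_le_of_lt ?_ hIJ
    rw [length_pairsL]
    have hrowlen : ∀ a, a < q → (Sl.getD a []).length ≤ ℓ₁ := by
      intro a ha
      rw [hSl_b a ha]
      have hnd : (innerRow (kctx M) q D₁ pd ws a).Nodup := List.nodup_range.filter _
      have hcard : (innerRow (kctx M) q D₁ pd ws a).length =
          (((innerRow (kctx M) q D₁ pd ws a).map (GF2.elt M)).toFinset).card := by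
        rw [List.toFinset_card_of_nodup ((List.nodup_map_iff_inj_on hnd).2 fun x hx y hy hxy =>
          GF2.elt_injective ((hmemRow a ha x).1 hx).1 ((hmemRow a ha y).1 hy).1 hxy), List.length_map]
      have hsub : ((innerRow (kctx M) q D₁ pd ws a).map (GF2.elt M)).toFinset ⊆
          QConv.innerList (labM M) (QConv.recv (labM M) P i zs) D₁ (GF2.elt M a) := fun v hv => by
        obtain ⟨vv, hvv, rfl⟩ := List.mem_map.1 (List.mem_toFinset.1 hv)
        exact ((hmemRow a ha vv).1 hvv).2
      have hJ := QConv.innerList_card_mul_sq_le (labM M) (QConv.recv (labM M) P i zs) D₁ (GF2.elt M a)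
      have h1 := (Finset.card_le_card hsub).trans (Nat.le_of_mul_le_mul_right (hJ.trans hℓ) (by positivity))
      rwa [← hcard] at h1
    have : ∀ x ∈ (List.range q).map (fun a => (Sl.getD a []).length), x ≤ ℓ₁ := fun x hx => by
      obtain ⟨a, ha, rfl⟩ := List.mem_map.1 hx
      exact hrowlen a (List.mem_range.1 ha)
    have h2 := List.sum_le_card_nsmul _ _ this
    rw [List.length_map, List.length_range, smul_eq_mul] at h2
    exact h2
  -- the survivors
  obtain ⟨hFmem, hTF, -, hFlen⟩ := survL_spec (I := I₁) (J := J₁) (D := d - 1) (A := A₁) (cap := cap₁) (r' := 0) hSlred hcount hA hcap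
    KRed.nil KRed.nil rfl Fin.elim0 Fin.elim0 (fun k => k.elim0) (fun k => k.elim0)
  rw [hF]
  refine ⟨fun u hu => ⟨by rw [(hFmem u hu).2]; omega, (hFmem u hu).1⟩, hFlen, ?_⟩
  -- (III) the set of values
  have hcands : ∀ f, f ∈ UmansRec.cands (d - 1) A₁ (SOf M Sl) ↔ ∃ p ∈ survL (kctx M) q I₁ J₁ (d - 1) A₁ cap₁ Sl [] [], polyOfList M p = f := by
    intro f
    rw [← hTF f, Finset.mem_filter]
    simp
  ext x
  rw [List.mem_toFinset, List.mem_map, predG, Finset.mem_image, QConv.listPred, ← hP, ← hzs, ← hinner]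
  constructor
  · rintro ⟨p, hp, rfl⟩
    have hplen : p.length = d := by rw [(hFmem p hp).2]; omega
    obtain ⟨z, hz, hzp⟩ := (mem_cands_iff_symPoly hd _).1 ((hcands _).2 ⟨p, hp, rfl⟩)
    refine ⟨z, hz, ?_⟩
    rw [ρN, ← QConv.symPoly_injective (hzp.trans (symPoly_coeffVec hplen).symm)]
  · rintro ⟨z, hz, rfl⟩
    obtain ⟨p, hp, hpz⟩ := (hcands _).1 ((mem_cands_iff_symPoly hd _).2 ⟨z, hz, rfl⟩)
    have hplen : p.length = d := by rw [(hFmem p hp).2]; omega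
    refine ⟨p, hp, ?_⟩
    rw [ρN, QConv.symPoly_injective ((symPoly_coeffVec hplen).trans hpz)]

end PredSpec

end UmansFP

end Literature.Computability.Complexity

end
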